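import Mathlib

/-!
# Bałaban's renormalization group for 4-d lattice Yang–Mills — shared typed vocabulary (`Setup`)

CITATION HEADER (lean-in-tree rule 2026-08-18). This module is a TYPED SKELETON of the NOTATION of the published series
T. Bałaban, *Comm. Math. Phys.* **95** 17–40 (1984) [Balaban1984PropagatorsI]; **98** 17–51 (1985) [Balaban1985Averaging]; **99** 75–102 (1985) [Balaban1985RegularSpaces];
**99** 389–434 (1985) [Balaban1985BackgroundPropagators]; **102** 255–275 (1985) [Balaban1985UV3]; **102** 277–309 (1985) [Balaban1985Variational]; **109** 249–301 (1987) [Balaban1987RG1];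
**119** 243–285 (1988) [Balaban1988Convergent]; **122** 175–202 (1989) [Balaban1989LargeFieldI]; **122** 355–392 (1989) [Balaban1989LargeFieldII]
(cell numbering B5–B16; J. Dimock, arXiv:1108.1335 [arXiv11081335] for comparison only).
WHAT IS REPRODUCED: definitions and statement SHAPES only (lattices, bond variables, block averaging, gauge fixing, renormalization
transformations as push-forward identities, coupling flows, background-field predicate, effective-action bookkeeping, small-field
predicates, constants) so that the per-paper modules of the audit cell `pub-balaban` share one vocabulary. NO theorem of the series is
asserted here; the series' end-statement (ultraviolet stability of 4-d lattice gauge theories) and in particular [Balaban1987RG1] Thm 2 (whose proof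
is announced there for a paper that did not appear) are CLAIMS UNDER ADJUDICATION by that cell — they enter other modules only as
named `Prop`s taken as hypotheses. Every schematic simplification relative to the printed definitions is listed in the cell's
DIVERGENCE.md (rows F1–F17) and summarised in the docstrings below ("WE TYPE").
RELATION TO EXISTING TREE MATERIAL (deliberately not reused, reviewers please note): `Literature.MathematicalPhysics.QuantumLattice`
(`BalabanRG.lean`: `blockMap`, `blockSites`, `axialBlockHolonomy`, `RunningCouplings`, `InWindow`, `smallFieldRegion`, `BlockRGScheme`,
`HasUVStabilityBounds`) works on `ℤ^d` with corner-based blocks, matrix groups and ONE lattice; this file follows [Balaban1987RG1] §0 literally —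
the finite tori `T^{(j)}_{L^j ε}` of (0.1) indexed by scale, CENTRED blocks (L odd), an abstract compact-group interface, and the
operator form (0.3)/(0.11)/(0.19) of the renormalization transformations — because the audit must quote the papers symbol by symbol.
A bridge between the two vocabularies is future work and is not claimed.
Staged in the cell package `run/shared/lean/pub/pub-balaban/lean/BalabanYm4/` at the same relative path (v1.4; the legacy module
`BalabanYm4.Setup` there, namespace `BalabanYm4`, is frozen at v1.1).
v1.2 = v1.1 + review of p175636: `GroupAverage` restricted to nonempty families of small diameter (as printed, B12 p. 253),
`HaarData` over a parameter `[MeasurableSpace G]`, standing range `j ≤ m + K` stated in `Params`.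
v1.3 = v1.2 + the cell's VACUITY AUDIT of this vocabulary (GAPS G-f1-3; kernel certificates in the sibling module
`…Balaban1983to89.AveragingRT`): (i) the two axioms of `Averaging` are now imposed only in the standing range `j + 1 ≤ m + K`
(out of range the tori degenerate and the unguarded axioms force `G` trivial for `d ≥ 2`, so every binder `av : ∀ j, Averaging P j G`
was unsatisfiable; DIVERGENCE F16) — a pure weakening of the two fields, no importer projects them; (ii) NEW carrier `RTOpI` =
renormalization transformation demanded on INTEGRABLE densities only (`RTOp`, which demands the push-forward identity for every
density including non-integrable signed ones, is uninhabited as soon as Haar measure on `G` is non-degenerate — Bochner-integral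
junk values; it is kept unchanged for its importers and flagged; DIVERGENCE F17); (iii) docstring errata (`Params`: `j = 0` is the
FINEST lattice; `Flow`: scope of the Markov carrier `β_{k+1}(g_k)`). No declaration of v1.2 changed its name or type otherwise.
v1.4 = v1.3 + (append-only, importer-safe; requested by the Step owner f2) the OPERATOR-LEVEL form `SmallFieldStepOp` of the
small-field step (0.19) — the step uses only the operator `T`, never the RT axioms — and its `RTOpI`-level form `SmallFieldStepI`,
with the `rfl` bridges `smallFieldStep_eq_op`, `smallFieldStepI_eq_op`, `smallFieldStep_iff_I` from the `RTOp` form, so that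
B12-Thm-3-shaped statements can migrate off the uninhabited carrier `RTOp` without restating (0.19). No v1.3 declaration changed.

# BalabanYm4.Setup — the common typed vocabulary (FOUNDATIONS 1, unit b2b-balaban-f1)

Statement-level scaffolding for the reconstruction of T. Balaban's lattice Yang–Mills ultraviolet-stability
series (Comm. Math. Phys. 1983–89; papers B4–B16 of `inputs/INDEX.md`).  Every identifier here corresponds to an
entry of `NOTATION.md` (HOME top level), which gives the source (paper, journal page, equation number) and the
verbatim formula; every SCHEMATIC SIMPLIFICATION made here relative to the printed definition is a row F1, F2, …
of `DIVERGENCE.md`.  Nothing in this file asserts that any theorem of the series holds: it only fixes types,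
names and the SHAPES of hypotheses, so that the per-paper files `BalabanYm4/B<k>.lean` share one vocabulary.

Conventions.
* Scales are indexed by the number of sites, not by a real lattice spacing: `Site P j` is the set of sites of
  Balaban's torus `T^{(j)}` (B12 (0.1)), `j = 0` the finest lattice `T_ε`, `j = K` the final unit lattice.  The
  spacing `η = L^{-k}` (B12 (1.2)) is pure bookkeeping: `Params.eta`.  Rescaling `S` (B5 p. 20) is therefore the
  identity on our types (DIVERGENCE F7).
* Gauge fields live on POSITIVELY ORIENTED bonds `⟨x, x + e_μ⟩` (B7 (5)–(7)); `U(x', x) = U(x, x')⁻¹` is derived.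
* The gauge group enters through the interface `GaugeGroup` (a group with the two real functions actually used in
  the statements: `dist1 g = |g - 1|` in the OPERATOR norm, B7 (19), and `reTr g = Re tr g` with the NORMALIZED
  trace, B12 (0.2)); the matrix realisation `G ⊂ U(N)`, the Lie algebra and the complexification `Gᶜ` are
  further type parameters where needed (DIVERGENCE F4).
-/

open scoped BigOperators
open _root_.MeasureTheory

namespace Literature.MathematicalPhysics.QuantumFieldTheory.Balaban1983to89

/-! ## 1. Parameters (NOTATION §1) -/

/-- Global parameters of the construction: dimension `d`, block size `L` (odd, `> 1`; B12 p. 251 prints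
"> 11", DIVERGENCE F1), volume exponent `m` (`L_μ = L^m`), number of RG steps `K` (`ε = L^{-K}`).  STANDING RANGE for
the lattice level `j` of `T^{(j)}` throughout the series and this module: `j ≤ m + K` (`j = 0` the FINEST lattice `T_ε` with
`2 L^{m+K}` sites per direction, `j = K` the unit lattice `T_1` of B12 (0.1), `j = m + K` the coarsest torus with 2 sites per
direction; v1.3 erratum: v1.0–v1.2 of this sentence misnamed `j = 0` "unit lattice"); `sitesPerDir`, `Site`, `blockOf`, `emb`
are total in `j` but only meaningful — and `blockOf ∘ emb = id` only holds — in that range (`blockOf` needs `j + 1 ≤ m + K`);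
later modules should quantify `j` accordingly, and the axioms of `Averaging` are imposed only there (v1.3).  `m` is not
constrained here (the series has `L_μ = L^m` with `m ≥ 1`; a statement needing it carries the hypothesis). [cite: Balaban1987RG1, §0 p.251] -/
structure Params where
  d : ℕ
  L : ℕ
  m : ℕ
  K : ℕ
  hd : 1 ≤ d
  hL : Odd L ∧ 1 < L

namespace Params

variable (P : Params)

/-- `ε = L^{-K}`, the initial lattice spacing (B12 (0.1)). [cite: Balaban1987RG1, (0.1) p.251] -/
noncomputable def eps : ℝ := ((P.L : ℝ)⁻¹) ^ P.K

/-- `η = L^{-k}`, the spacing of the finest lattice in the units of step `k` (B12 (1.2)); `ξ = L^{-j}` is `eta j`. [cite: Balaban1987RG1, (1.1) p.260] -/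
noncomputable def eta (k : ℕ) : ℝ := ((P.L : ℝ)⁻¹) ^ k

/-- Number of sites per direction of `T^{(j)}`: `2 L^{m+K-j}` (B12 (0.1) with `ε ↦ L^j ε`; DIVERGENCE F2). [cite: Balaban1987RG1, (0.1) p.251] -/
def sitesPerDir (j : ℕ) : ℕ := 2 * P.L ^ (P.m + P.K - j)

/-- `0 < L` (from `1 < L`). [folklore] -/
lemma L_pos : 0 < P.L := by have := P.hL.2; omega

/-- The site count per direction is nonzero. [folklore] -/
lemma sitesPerDir_ne_zero (j : ℕ) : P.sitesPerDir j ≠ 0 := by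
  unfold sitesPerDir
  exact mul_ne_zero two_ne_zero (pow_ne_zero _ (by have := P.hL.2; omega))

/-- `NeZero` instance for the site count (needed by `ZMod`). [folklore] -/
instance (j : ℕ) : NeZero (P.sitesPerDir j) := ⟨P.sitesPerDir_ne_zero j⟩

end Params

/-! ## 2. Lattices: sites, bonds, plaquettes, blocks (NOTATION §2) -/

/-- Sites of the torus `T^{(j)}` : `d` coordinates modulo `sitesPerDir j` (standing range `j ≤ m + K`, see `Params`). [cite: Balaban1987RG1, (0.1) p.251] -/
def Site (P : Params) (j : ℕ) : Type := Fin P.d → ZMod (P.sitesPerDir j)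

namespace Site
variable {P : Params} {j : ℕ}

/-- Sites of a finite torus form a finite type. [folklore] -/
instance : Fintype (Site P j) := inferInstanceAs (Fintype (Fin P.d → ZMod (P.sitesPerDir j)))
/-- Decidable equality of sites. [folklore] -/
instance : DecidableEq (Site P j) := inferInstanceAs (DecidableEq (Fin P.d → ZMod (P.sitesPerDir j)))
/-- The origin as default site. [folklore] -/
instance : Inhabited (Site P j) := ⟨fun _ => 0⟩

/-- `x + e_μ` (one lattice step in direction `μ`). [folklore] -/
def shift (x : Site P j) (μ : Fin P.d) : Site P j := Function.update x μ (x μ + 1)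

/-- `x - e_μ`. [folklore] -/
def unshift (x : Site P j) (μ : Fin P.d) : Site P j := Function.update x μ (x μ - 1)

/-- The `ℓ¹` torus distance in LATTICE UNITS of scale `j` (number of steps); `|x - y|` of the papers is `spacing · tdist x y`
(up to the choice of `ℓ¹`/`ℓ^∞`, immaterial for statements of the form `exp(-δ|x-y|)` with unspecified `δ`; DIVERGENCE F2). [folklore] -/
def tdist (x y : Site P j) : ℕ := ∑ μ : Fin P.d, min (x μ - y μ).val (y μ - x μ).val

end Site

/-- Positively oriented bonds `⟨x, x + e_μ⟩` of `T^{(j)}` (B7 (5)): a pair (initial point, direction). [cite: Balaban1985Averaging, (5) p.18] -/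
structure PBond (P : Params) (j : ℕ) where
  src : Site P j
  dir : Fin P.d

namespace PBond
variable {P : Params} {j : ℕ}
/-- final point `b₊`. [folklore] -/
def tgt (b : PBond P j) : Site P j := b.src.shift b.dir

/-- Positively oriented bonds form a finite type. [folklore] -/
instance : Fintype (PBond P j) :=
  Fintype.ofEquiv (Site P j × Fin P.d) ⟨fun p => ⟨p.1, p.2⟩, fun b => (b.src, b.dir), fun _ => rfl, fun _ => rfl⟩
end PBond

/-- Positively oriented plaquettes `p = ⟨x, x+e_μ, x+e_μ+e_ν, x+e_ν⟩`, `μ < ν` (B7 (5)). [cite: Balaban1985Averaging, (5) p.18] -/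
structure Plaq (P : Params) (j : ℕ) where
  src : Site P j
  μ : Fin P.d
  ν : Fin P.d
  hμν : μ < ν

namespace Plaq
variable {P : Params} {j : ℕ}
/-- Plaquettes form a finite type. [folklore] -/
instance : Fintype (Plaq P j) :=
  Fintype.ofEquiv {t : Site P j × Fin P.d × Fin P.d // t.2.1 < t.2.2}
    ⟨fun t => ⟨t.1.1, t.1.2.1, t.1.2.2, t.2⟩, fun p => ⟨(p.src, p.μ, p.ν), p.hμν⟩,
     fun _ => rfl, fun _ => rfl⟩
end Plaq

/-- The standard block map `T^{(j)} → T^{(j+1)}`: the coarse site `y` with `x ∈ B(y) = Δ(y) ∩ T^{(j)}` (B12 (0.3)).  In the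
integer labels `n ↦ (n + ½)·spacing` of B12 (0.1) (sites = CENTRES of cubes, B12 p. 251) the cube `Δ(y)`, `y` of label `n`, contains
exactly the fine labels `nL, …, nL + L - 1`, so `blockOf` is integer division by `L` coordinatewise — this is B12's centred convention
verbatim (for `j + 1 ≤ m + K`); B5 (1.5)/B7 (2) use CORNER-anchored blocks instead (DIVERGENCE F3). [cite: Balaban1987RG1, (0.1) p.252] -/
def blockOf {P : Params} {j : ℕ} (x : Site P j) : Site P (j+1) :=
  fun μ => (((x μ).val / P.L : ℕ) : ZMod (P.sitesPerDir (j+1)))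

/-- The inclusion `T^{(j+1)} ⊂ T^{(j)}` (B12 p. 251: the coarse sites are the centres `y` of the cubes `Δ(y)`, and a centre is itself a
fine site because `L` is odd): label `n ↦ nL + (L-1)/2`.  (B5/B7's corner convention would be `n ↦ nL`; DIVERGENCE F3.) [cite: Balaban1987RG1, (0.1) p.252] -/
def emb {P : Params} {j : ℕ} (y : Site P (j+1)) : Site P j :=
  fun μ => (((y μ).val * P.L + (P.L - 1) / 2 : ℕ) : ZMod (P.sitesPerDir j))

/-- The block `B(y) ⊂ T^{(j)}` of a coarse site `y` (B12 (0.3)), as a `Finset`. [cite: Balaban1987RG1, (0.1) p.252] -/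
def block {P : Params} {j : ℕ} (y : Site P (j+1)) : Finset (Site P j) :=
  Finset.univ.filter (fun x => blockOf x = y)

/-! ## 3. The gauge group interface and norms (NOTATION §3) -/

/-- Interface for the gauge group `G ⊂ U(N)` (or a neighbourhood of it in `Gᶜ`): a group together with
`dist1 g = |g - 1|` (operator norm, B7 (19)) and `reTr g = Re tr g` (normalized trace, `tr 1 = 1`, B12 (0.2)),
and the elementary identities used in bookkeeping.  The matrix model is NOT fixed here (DIVERGENCE F4). [cite: Balaban1985Averaging, (19) p.21] -/
class GaugeGroup (G : Type*) extends Group G where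
  dist1 : G → ℝ
  reTr : G → ℝ
  dist1_nonneg : ∀ g, 0 ≤ dist1 g
  dist1_one : dist1 1 = 0
  dist1_inv : ∀ g, dist1 g⁻¹ = dist1 g
  dist1_conj : ∀ g h, dist1 (h * g * h⁻¹) = dist1 g
  dist1_mul_le : ∀ g h, dist1 (g * h) ≤ dist1 g + dist1 h
  reTr_one : reTr 1 = 1
  reTr_le_one : ∀ g, reTr g ≤ 1
  reTr_inv : ∀ g, reTr g⁻¹ = reTr g
  reTr_conj : ∀ g h, reTr (h * g * h⁻¹) = reTr g

export GaugeGroup (dist1 reTr)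

/-! ## 4. Gauge fields, gauge transformations, plaquette variables (NOTATION §4) -/

/-- A gauge field configuration on `T^{(j)}`: bond variables `U(b) ∈ G` on positively oriented bonds. [cite: Balaban1985Averaging, (3) p.18] -/
def GaugeField (P : Params) (j : ℕ) (G : Type*) : Type _ := PBond P j → G

/-- A gauge transformation `u : T^{(j)} → G`. [cite: Balaban1985Averaging, (8) p.19] -/
def GaugeTransf (P : Params) (j : ℕ) (G : Type*) : Type _ := Site P j → G

namespace GaugeField
variable {P : Params} {j : ℕ} {G : Type*} [GaugeGroup G]

/-- The trivial configuration `U = 1`. -/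
instance : One (GaugeField P j G) := ⟨fun _ => 1⟩
/-- The trivial configuration `U ≡ 1` as default. [folklore] -/
instance : Inhabited (GaugeField P j G) := ⟨1⟩

/-- `U^u(x, x') = u(x) U(x, x') u(x')⁻¹` (B7 (8)). [cite: Balaban1985Averaging, (8) p.19] -/
def gaugeAct (u : GaugeTransf P j G) (U : GaugeField P j G) : GaugeField P j G :=
  fun b => u b.src * U b * (u b.tgt)⁻¹

/-- Plaquette variable `U(∂p) = U(x,x+e_μ) U(x+e_μ,x+e_μ+e_ν) U(x+e_ν,x+e_μ+e_ν)⁻¹ U(x,x+e_ν)⁻¹` (B7 (9), B12 p. 252). [cite: Balaban1985Averaging, (9) p.19] -/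
def plaqHol (U : GaugeField P j G) (p : Plaq P j) : G :=
  U ⟨p.src, p.μ⟩ * U ⟨p.src.shift p.μ, p.ν⟩ * (U ⟨p.src.shift p.ν, p.μ⟩)⁻¹ * (U ⟨p.src, p.ν⟩)⁻¹

/-- Gauge invariance of a function of the gauge field (B7 (12)–(13)). [cite: Balaban1985Averaging, (12) p.19] -/
def GaugeInvariant {α : Type*} (F : GaugeField P j G → α) : Prop :=
  ∀ (u : GaugeTransf P j G) (U : GaugeField P j G), F (gaugeAct u U) = F U

end GaugeField

/-! ## 4b. Lie-algebra-valued (vector) fields and propagator kernels (NOTATION §3, §4; B4–B6, B9) -/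

/-- A vector field `A : bonds → V` (`V` = the Lie algebra `g`, or `gᶜ`, or `ℝ`; B5 §1: "vector fields on the lattice"). [cite: Balaban1984PropagatorsI, (1.1) p.18] -/
abbrev VecField (P : Params) (j : ℕ) (V : Type*) : Type _ := PBond P j → V

/-- A scalar (site) field `λ : sites → V` (gauge-transformation generators, auxiliary fields). [cite: Balaban1984PropagatorsI, (1.4) p.18] -/
abbrev SiteField (P : Params) (j : ℕ) (V : Type*) : Type _ := Site P j → V

/-- A LINEAR block-averaging operator `Q` on vector fields (B5 (1.6)–(1.8): `(QA)(c) = Σ_{x ∈ B(c₋)} L^{-d} A(Γ_{c,x})`-type averages),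
axiomatised by linearity and locality exactly like `Averaging` (the contour formula is recorded in NOTATION §6.1; DIVERGENCE F6). [cite: Balaban1984PropagatorsI, (1.11) p.19] -/
structure LinAveraging (P : Params) (j : ℕ) (V : Type*) [AddCommGroup V] [Module ℝ V] where
  Q : VecField P j V →ₗ[ℝ] VecField P (j+1) V
  local_dep : ∀ (A A' : VecField P j V) (c : PBond P (j+1)),
    (∀ b : PBond P j, (blockOf b.src = c.src ∨ blockOf b.src = c.tgt) → A b = A' b) → Q A c = Q A' c

/-- A (propagator) kernel between bonds of `T^{(j)}`, real-valued entries (matrix elements of `G_k`, `G(U)`, … in a basis are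
reader-level; statements only use bounds on entries). [cite: Balaban1985BackgroundPropagators, §0 p.390] -/
abbrev BondKernel (P : Params) (j : ℕ) : Type := PBond P j → PBond P j → ℝ

/-- The exponential decay bound `|G(b, b')| ≤ C exp(-δ₀ |b₋ - b'₋|)` with the distance in units of the spacing `s` of `T^{(j)}`
(B4 Thm p. 573, B5 Prop 1.1 (1.90), B9 Thm 3.1: `δ₀ > 0` and `C` independent of the volume and of `k`). [cite: Balaban1987RG1, (1.18) p.263] -/
def KernelExpDecay {P : Params} {j : ℕ} (Gk : BondKernel P j) (C δ₀ s : ℝ) : Prop :=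
  ∀ b b' : PBond P j, |Gk b b'| ≤ C * Real.exp (-δ₀ * s * (Site.tdist b.src b'.src : ℝ))

/-! ## 5. Actions (NOTATION §5) -/

section Actions
variable {P : Params} {j : ℕ} {G : Type*} [GaugeGroup G]

/-- Wilson action `A^ε(U) = Σ_p ε^{d-4} [1 - Re tr U(∂p)]` (B12 (0.2)); the weight `ε^{d-4}` is passed as the real
number `w` (`w = 1` for `d = 4`, `w = eta^{d-4}` otherwise), so that `d = 3, 4` share one definition. [cite: Balaban1987RG1, (0.2) p.252] -/
noncomputable def wilsonAction (w : ℝ) (U : GaugeField P j G) : ℝ :=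
  ∑ p : Plaq P j, w * (1 - reTr (GaugeField.plaqHol U p))

/-- The `d = 4` Wilson action `A(U) = Σ_p [1 - Re tr U(∂p)]`. [cite: Balaban1987RG1, (0.2) p.252] -/
noncomputable def wilsonAction4 (U : GaugeField P j G) : ℝ := wilsonAction 1 U

/-- The Wilson action with unit weight is nonnegative (each term `1 − Re tr U(∂p) ≥ 0`). [folklore] -/
lemma wilsonAction4_nonneg (U : GaugeField P j G) : 0 ≤ wilsonAction4 U := by
  unfold wilsonAction4 wilsonAction
  refine Finset.sum_nonneg fun p _ => ?_
  have := GaugeGroup.reTr_le_one (GaugeField.plaqHol U p)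
  linarith

end Actions

/-! ## 6. Averaging operations (NOTATION §6) -/

/-- An AVERAGING OPERATION `U ↦ Ū` from gauge fields on `T^{(j)}` to gauge fields on `T^{(j+1)}` in the
axiomatic sense of B7 p. 19 / B12 p. 254 / B14 p. 243: gauge covariance (B7 (11)) and locality (`Ū(c)` depends
only on `U` on bonds issuing from the blocks `B(c₋)`, `B(c₊)`).  The concrete formulas B7 (15) = B12 (0.12) and
B12 (0.4) are recorded in NOTATION §6.2; the first-order agreement with the linear average (B7 (14)) and
analyticity are NOT encoded (DIVERGENCE F6).  RANGE GUARD (v1.3, DIVERGENCE F16, GAPS G-f1-3): both axioms are imposed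
only in the standing range `j + 1 ≤ m + K` of `Params`; out of that range `Site P j` and `Site P (j+1)` both degenerate to
2 sites per direction, `blockOf` is constantly `0`, the locality premise is then vacuous on bonds `c` avoiding the block of `0`,
and covariance at such a `c` forces `g = u(c₋) g u(c₊)⁻¹` for all `u`, i.e. `G` trivial (`d ≥ 2`) — so WITHOUT the guard the type
`∀ j, Averaging P j G` used by `Averaging.iter` and every later module was EMPTY for non-trivial `G` (kernel certificate in
the sibling module `…Balaban1983to89.AveragingRT`, cell unit f1, proposed together with v1.3); with it, `∀ j, Averaging P j G` is
inhabited by the axial (straight-line) decimation average (same module), and in range nothing changed. [cite: Balaban1985Averaging, (3) p.18] -/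
structure Averaging (P : Params) (j : ℕ) (G : Type*) [GaugeGroup G] where
  avg : GaugeField P j G → GaugeField P (j+1) G
  covariant : j + 1 ≤ P.m + P.K → ∀ (u : GaugeTransf P j G) (U : GaugeField P j G),
    avg (GaugeField.gaugeAct u U) = GaugeField.gaugeAct (fun y => u (emb y)) (avg U)
  local_dep : j + 1 ≤ P.m + P.K → ∀ (U U' : GaugeField P j G) (c : PBond P (j+1)),
    (∀ b : PBond P j, (blockOf b.src = c.src ∨ blockOf b.src = c.tgt) → U b = U' b) → avg U c = avg U' c

namespace Averaging
variable {P : Params} {G : Type*} [GaugeGroup G]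

/-- The `k`-fold iterate `Ū^k = M^k(U)` of a family of one-step averagings, from the finest lattice `T^{(0)}` to
`T^{(k)}` (B12 (0.21)). [cite: Balaban1987RG1, (0.11) p.253] -/
def iter (av : ∀ j, Averaging P j G) : (k : ℕ) → GaugeField P 0 G → GaugeField P k G
  | 0 => id
  | k+1 => (av k).avg ∘ iter av k

end Averaging

/-- A finite family `{U_j : j = 1, …, n}` (`n ≥ 1`) has diameter `< δ`: all `|U_i U_k⁻¹ - 1| < δ`.  B12 p. 253 defines the
average `M` only "on sets `{U_j : j = 1, 2, …, n}`, `U_j ∈ Gᶜ`, with sufficiently small diameters". [cite: Balaban1987RG1, (0.5) p.253] -/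
def FamilySmall {G : Type*} [GaugeGroup G] (δ : ℝ) {n : ℕ} (U : Fin (n+1) → G) : Prop :=
  ∀ i k : Fin (n+1), dist1 (U i * (U k)⁻¹) < δ

/-- Axiomatic average `M({U_j})` of a NONEMPTY finite family of group elements of diameter `< δ` (B12 (0.5)–(0.7),
p. 253: "a Gᶜ-valued function defined on sets `{U_j : j = 1, 2, …, n}` … with sufficiently small diameters").  `M` is
typed as a total function (values off the small-diameter domain are unconstrained junk); the axioms (0.5) inversion,
(0.6) two-sided equivariance, (0.7) permutation invariance are imposed ONLY on families with `FamilySmall δ`.  Not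
encoded: complex values `Gᶜ`, analyticity, (0.8) (first-order agreement with the mean of the Lie-algebra elements),
(0.9) (DIVERGENCE F4/F6).  Typing note (review of p175636): with the axioms imposed on ALL families, including the
empty one, the structure forces `G` trivial; even on all pairs `(1, g)` it forces an equivariant square root of every
`g`, which fails on `SU(2)` at `g = -1` — hence the domain restriction is essential, exactly as printed. [cite: Balaban1987RG1, (0.5) p.253] -/
structure GroupAverage (G : Type*) [GaugeGroup G] where
  δ : ℝ
  δ_pos : 0 < δ
  M : ∀ {n : ℕ}, (Fin (n+1) → G) → G
  inv : ∀ {n : ℕ} (U : Fin (n+1) → G), FamilySmall δ U → M (fun i => (U i)⁻¹) = (M U)⁻¹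
  equivariant : ∀ {n : ℕ} (U : Fin (n+1) → G), FamilySmall δ U → ∀ u v : G, M (fun i => u * U i * v) = u * M U * v
  perm : ∀ {n : ℕ} (U : Fin (n+1) → G), FamilySmall δ U → ∀ σ : Equiv.Perm (Fin (n+1)), M (U ∘ σ) = M U

/-- Averaged contour variables `U(y, x)`, `y ∈ T^{(j+1)}`, `x ∈ B(y)` (B12 (0.11)), abstracted as a gauge-covariant
assignment (the contour families `G(y,x)`, `Γ_{y,x}` of B12 p. 252 / B5 (1.7) are not modelled: DIVERGENCE F6). [cite: Balaban1987RG1, (0.8) p.253] -/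
structure ContourData (P : Params) (j : ℕ) (G : Type*) [GaugeGroup G] where
  holTo : GaugeField P j G → Site P (j+1) → Site P j → G
  covariant : ∀ (u : GaugeTransf P j G) (U : GaugeField P j G) (y : Site P (j+1)) (x : Site P j),
    holTo (GaugeField.gaugeAct u U) y x = u (emb y) * holTo U y x * (u x)⁻¹

/-! ## 7. Gauge fixing (NOTATION §7) -/

section GaugeFixing
variable {P : Params} {j : ℕ} {G : Type*} [GaugeGroup G]

/-- Block axial gauge `Ax`: `U(Γ_{y,x}) = 1` for `x ∈ B(y)`, `x ≠ y` (B5 (1.10), B12 p. 254, B14 `χ_{Ax}`). [cite: Balaban1984PropagatorsI, (1.10) p.19] -/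
def AxialGauge (cd : ContourData P j G) (U : GaugeField P j G) : Prop :=
  ∀ (y : Site P (j+1)) (x : Site P j), blockOf x = y → x ≠ emb y → cd.holTo U y x = 1

/-- The gauge-fixing function `G(Y, U) = Σ_{y ∈ Y} Σ_{x ∈ B(y), x ≠ y} [1 - Re tr U(y,x)]` (B12 (0.17), B14 (1.7)). [cite: Balaban1987RG1, (0.17) p.255] -/
noncomputable def gaugeFixFn (cd : ContourData P j G) (Y : Finset (Site P (j+1))) (U : GaugeField P j G) : ℝ :=
  ∑ y ∈ Y, ∑ x ∈ (block y).erase (emb y), (1 - reTr (cd.holTo U y x))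

/-- The exponential (Euclidean-invariant) gauge-fixing weight `exp[-(1/α) Σ [1 - Re tr U(y,x)]]` (B12 (0.14)–(0.16));
in the `k`-th step `α = g_k²`. [cite: Balaban1987RG1, (0.12) p.254] -/
noncomputable def expGaugeFixWeight (cd : ContourData P j G) (α : ℝ) (U : GaugeField P j G) : ℝ :=
  Real.exp (-(1 / α) * gaugeFixFn cd Finset.univ U)

end GaugeFixing

/-! ## 8. Densities, Haar data, renormalization transformations (NOTATION §8) -/

/-- Normalized Haar measure on the compact group `G` as DATA (invariance and normalisation as fields), over a GIVEN
measurable structure `[MeasurableSpace G]` (a parameter, not provided by the class, so that a concrete group carrying its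
Borel structure gets no second, non-defeq one — review of p175636). [folklore] -/
class HaarData (G : Type*) [GaugeGroup G] [MeasurableSpace G] where
  haar : Measure G
  isProb : IsProbabilityMeasure haar
  map_mul_left : ∀ g : G, haar.map (fun h => g * h) = haar
  map_mul_right : ∀ g : G, haar.map (fun h => h * g) = haar
  map_inv : haar.map (fun h => h⁻¹) = haar

section RT
variable (P : Params) (j : ℕ) (G : Type*) [GaugeGroup G] [MeasurableSpace G] [HaarData G]

/-- A density (function of the gauge field) on `T^{(j)}`; `ρ_k`, `exp A_k`, characteristic functions, … [cite: Balaban1987RG1, (0.3) p.252] -/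
abbrev Density : Type _ := GaugeField P j G → ℝ

/-- Product measurable structure on configurations `PBond → G`. [folklore] -/
instance : MeasurableSpace (GaugeField P j G) := inferInstanceAs (MeasurableSpace (PBond P j → G))

/-- Product Haar measure `dU = Π_b dU(b)` on gauge fields of `T^{(j)}` (B7 (10)). [cite: Balaban1985Averaging, (10) p.19] -/
noncomputable def fieldMeasure : Measure (GaugeField P j G) :=
  Measure.pi (fun _ : PBond P j => (HaarData.haar : Measure G))

variable {P j G}

/-- `IsRT avg ρ ρ'`: `ρ'` is the renormalization transform `(Tρ)(V) = ∫ dU δ(Ū V⁻¹) ρ(U)` of `ρ` (B7 (10), B14 (0.1)),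
in the push-forward reading `∫ dV ρ'(V) f(V) = ∫ dU ρ(U) f(Ū)` for bounded measurable `f` (DIVERGENCE F7:
the pointwise δ-function definition of the scans is replaced by this a.e. characterisation). [cite: Balaban1985Averaging, (10) p.19] -/
def IsRT (avg : GaugeField P j G → GaugeField P (j+1) G) (ρ : Density P j G) (ρ' : Density P (j+1) G) : Prop :=
  ∀ f : GaugeField P (j+1) G → ℝ, Measurable f → (∃ C : ℝ, ∀ V, |f V| ≤ C) →
    ∫ V, ρ' V * f V ∂(fieldMeasure P (j+1) G) = ∫ U, ρ U * f (avg U) ∂(fieldMeasure P j G)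

/-- A renormalization transformation as an OPERATOR on densities (B12 (0.13) `(Tρ)(V) = ∫ dU t(V,U) ρ(U)`),
specified by the push-forward identity; positivity-preservation recorded.  VACUITY FLAG (v1.3, DIVERGENCE F17, GAPS G-f1-3):
`isRT` is demanded here for EVERY `ρ : Density P j G`, including non-measurable and non-integrable signed densities, for which
the Bochner integrals in `IsRT` take junk values; as soon as Haar measure on `G` has a measurable set of measure strictly between
`0` and `1` and a non-integrable non-negative measurable function (every non-finite compact Lie group), NO operator `T` satisfies
this — kernel certificate in the sibling module `…AveragingRT` — so every hypothesis `Tk : ∀ k, RTOp P k G (av k)` of later modules is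
unsatisfiable as typed (their conclusions are unaffected; the theorems are vacuous).  This declaration is KEPT UNCHANGED because
importers project `.T`/`.isRT`/`.pos`; the inhabited replacement is `RTOpI` below (same fields, `isRT` asked only of integrable
densities), to which consumers should migrate. [cite: Balaban1987RG1, (0.3) p.252] -/
structure RTOp (P : Params) (j : ℕ) (G : Type*) [GaugeGroup G] [MeasurableSpace G] [HaarData G]
    (av : Averaging P j G) where
  T : Density P j G → Density P (j+1) G
  isRT : ∀ ρ, IsRT av.avg ρ (T ρ)
  pos : ∀ ρ, (∀ U, 0 ≤ ρ U) → ∀ V, 0 ≤ T ρ V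

/-- A renormalization transformation as an OPERATOR on densities (B12 (0.13) `(Tρ)(V) = ∫ dU t(V,U) ρ(U)`, B7 (10),
B14 (0.1)), v1.3 INHABITED form of `RTOp` (DIVERGENCE F17): the push-forward identity `IsRT` is demanded only for densities
`ρ` that are INTEGRABLE for the product Haar measure `dU` (the printed densities `exp(−A)`, `χ exp(−A)`, … are bounded and
continuous, hence integrable on the compact configuration space, so nothing printed is lost); positivity-preservation as in
`RTOp`.  Inhabited for every Haar-compatible measurable averaging (`Measure.map avg dU = dV`), in particular for the axial
decimation average (sibling module `…AveragingRT`: conditional-expectation / Radon–Nikodym construction). [cite: Balaban1987RG1, (0.3) p.252] -/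
structure RTOpI (P : Params) (j : ℕ) (G : Type*) [GaugeGroup G] [MeasurableSpace G] [HaarData G]
    (av : Averaging P j G) where
  T : Density P j G → Density P (j+1) G
  isRT : ∀ ρ, Integrable ρ (fieldMeasure P j G) → IsRT av.avg ρ (T ρ)
  pos : ∀ ρ, (∀ U, 0 ≤ ρ U) → ∀ V, 0 ≤ T ρ V

/-- Every `RTOp` restricts to an `RTOpI` (forgetting the identity on non-integrable densities). [folklore] -/
def RTOp.toRTOpI {P : Params} {j : ℕ} {G : Type*} [GaugeGroup G] [MeasurableSpace G] [HaarData G]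
    {av : Averaging P j G} (T : RTOp P j G av) : RTOpI P j G av where
  T := T.T
  isRT := fun ρ _ => T.isRT ρ
  pos := T.pos

/-- The normalisation property `∫ dV (Rρ)(V) = ∫ dV ρ(V)` of the large-field operation `R` (B15 (0.4)); the
operation itself (B15 (0.3)/(0.6), B16) is reader-owned and enters only through such properties (DIVERGENCE F9). [cite: Balaban1989LargeFieldI, (0.4) p.176] -/
def PreservesIntegral (R : Density P j G → Density P j G) : Prop :=
  ∀ ρ, ∫ V, R ρ V ∂(fieldMeasure P j G) = ∫ V, ρ V ∂(fieldMeasure P j G)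

end RT

/-! ## 9. Coupling constants and β-functions (NOTATION §9) -/

/-- The sequence of effective couplings `g_k` and β-functions `β_k` (B12 (0.18), (0.20)).  SCOPE (v1.3 docstring erratum,
NOTATION §9, GAPS G-ref2-1): `β : ℕ → ℝ → ℝ`, `β_{k+1}` a function of `g_k` alone, is the MARKOV / single-run reading — literally
what (0.18)/(0.20) print ("β_{k+1}(g_k)") and what B12 Thm 2, (0.31) and B14 (2.24) consume along ONE run; B12 p. 298 (§5, last
paragraph): "We write β_j as explicitly dependent on g_{j−1}, although it depends also on all preceding coupling constants."  The
map-level carrier WITH history `(g_0, …, g_k) ↦ β_{k+1}` is `FlowStep.HBeta` / `B12Beta` (sibling modules); statements uniform over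
runs must say which carrier they quantify over. [cite: Balaban1987RG1, (0.20) p.256] -/
structure Flow where
  g : ℕ → ℝ
  β : ℕ → ℝ → ℝ

namespace Flow

/-- The recursive renormalization group equations `1/g_k² = 1/g_{k+1}² + β_{k+1}(g_k)`, `k < K` (B12 (0.20)). [cite: Balaban1987RG1, (0.20) p.256] -/
def SatisfiesRG (F : Flow) (K : ℕ) : Prop :=
  ∀ k < K, 1 / (F.g k) ^ 2 = 1 / (F.g (k+1)) ^ 2 + F.β (k+1) (F.g k)

/-- The standing hypothesis of every `d = 4` theorem of the series: `0 < g_k ≤ γ` for `k = 0, …, K`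
(B12 Thm 1/3; discharged only by the unpublished B12 Thm 2 — GAPS.md G1). [cite: Balaban1987RG1, Thm 1 p.256] -/
def InInterval (F : Flow) (γ : ℝ) (K : ℕ) : Prop := ∀ k ≤ K, 0 < F.g k ∧ F.g k ≤ γ

/-- The two-sided logarithmic running (B12 (0.31)): `1/g² + β log(L^k ε)⁻¹ ≤ 1/g_k² ≤ 1/g² + β' log(L^k ε)⁻¹`. [cite: Balaban1987RG1, (0.31) p.259] -/
def LogRunning (F : Flow) (P : Params) (g β β' : ℝ) : Prop :=
  ∀ k ≤ P.K, 1 / g ^ 2 + β * Real.log ((P.L : ℝ) ^ k * P.eps)⁻¹ ≤ 1 / (F.g k) ^ 2 ∧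
    1 / (F.g k) ^ 2 ≤ 1 / g ^ 2 + β' * Real.log ((P.L : ℝ) ^ k * P.eps)⁻¹

end Flow

/-! ## 10. Small-field conditions, regular spaces (NOTATION §12) -/

section SmallField
variable {P : Params} {j : ℕ} {G : Type*} [GaugeGroup G]

/-- `|U(∂p) - 1| < δ` for all plaquettes (B12 p. 254 "regular configurations", with `δ = ε₀`; B12 (1.2) with
`δ = ε₀ η²`; B15 (1.3) with `δ = ε_j (L^{k-j} η)²`). [cite: Balaban1987RG1, (0.18) p.255] -/
def PlaqSmall (δ : ℝ) (U : GaugeField P j G) : Prop :=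
  ∀ p : Plaq P j, dist1 (GaugeField.plaqHol U p) < δ

/-- The same restricted to a set of plaquettes (large/small-field regions are unions of cubes; B14 (1.1)). [cite: Balaban1988Convergent, (1.4) p.247] -/
def PlaqSmallOn (S : Set (Plaq P j)) (δ : ℝ) (U : GaugeField P j G) : Prop :=
  ∀ p ∈ S, dist1 (GaugeField.plaqHol U p) < δ

open Classical in
/-- The characteristic function `χ({|U(∂p) - 1| < δ, p ∈ S})` as a real-valued density factor (B14 (1.1)). [cite: Balaban1988Convergent, (1.4) p.247] -/
noncomputable def chiSmall (S : Set (Plaq P j)) (δ : ℝ) (U : GaugeField P j G) : ℝ :=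
  if PlaqSmallOn S δ U then 1 else 0

/-- The pair of variables `(U, J)` on which localized action terms depend (B12 (1.9)–(1.10)); `J` takes values in a
normed space `A` standing for the (complexified) Lie algebra `gᶜ` (DIVERGENCE F4). [cite: Balaban1987RG1, (1.2) p.260] -/
structure FieldPair (P : Params) (j : ℕ) (G : Type*) (A : Type*) where
  U : GaugeField P j G
  J : PBond P j → A

/-- The REAL regular space `U_k(ε₀)` of B12 (1.2): `|U(∂p) - 1| < ε₀ η²` on `T` and `|J| < ε₀` on `T`, `η = L^{-k}`,
for configurations on the finest lattice `T^{(0)} = T_η`. [cite: Balaban1987RG1, (1.2) p.260] -/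
def RegularSpace {A : Type*} [NormedAddCommGroup A] (P : Params) (k : ℕ) (ε₀ : ℝ) :
    Set (FieldPair P 0 G A) :=
  {Φ | PlaqSmall (ε₀ * (P.eta k) ^ 2) Φ.U ∧ ∀ b, ‖Φ.J b‖ < ε₀}

/-- The small-field threshold profile `p₀(g) = A₀ (log g⁻²)^{p₀}` and `ε_k = g_k p₀(g_k)`, `δ_k = (A₁/A₀) ε_k`
(B14 p. 246–247). [cite: Balaban1988Convergent, (1.1) p.246] -/
noncomputable def p0Profile (A₀ : ℝ) (p₀ : ℕ) (g : ℝ) : ℝ := A₀ * (Real.log (g ^ 2)⁻¹) ^ p₀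

/-- `ε_k = g_k · p₀(g_k)` along a flow ([B14] (1.4) p.246). [cite: Balaban1988Convergent, (1.4) p.246] -/
noncomputable def epsK (A₀ : ℝ) (p₀ : ℕ) (F : Flow) (k : ℕ) : ℝ := F.g k * p0Profile A₀ p₀ (F.g k)

/-- `δ_k = (A₁/A₀) · ε_k` ([B14] (1.8) p.247: `δ_0 = (A_1/A_0) ε_0`). [cite: Balaban1988Convergent, (1.8) p.247] -/
noncomputable def deltaK (A₀ A₁ : ℝ) (p₀ : ℕ) (F : Flow) (k : ℕ) : ℝ := (A₁ / A₀) * epsK A₀ p₀ F k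

end SmallField

/-! ## 11. Localization domains and localized expansions (NOTATION §2.4, §11) -/

/-- The system of localization domains `D_j` at one scale (B12 p. 257): a finite type of domains `X` (connected unions
of `M`-cubes of `π_j`) with the tree length `d_j(X) ≥ 0`.  The cube geometry is abstracted (DIVERGENCE F5). [cite: Balaban1987RG1, §0 p.257] -/
structure LocDomainSys where
  Dom : Type
  [fin : Fintype Dom]
  dj : Dom → ℝ
  dj_nonneg : ∀ X, 0 ≤ dj X

attribute [instance] LocDomainSys.fin

/-- A localized expansion `E = Σ_{X ∈ D_j} E(X, ·)` of a function of (complex) configurations `Φ` (B12 (0.24), (1.7)),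
with values in `ℂ` (analytic functions of complexified fields; real on real fields). [cite: Balaban1987RG1, (0.23) p.257] -/
structure LocExpansion (Φ : Type*) where
  sys : LocDomainSys
  E : sys.Dom → Φ → ℂ

namespace LocExpansion
variable {Φ : Type*}

/-- `E(φ) = Σ_X E(X, φ)` (B12 (0.24)). [cite: Balaban1987RG1, (0.24) p.257] -/
noncomputable def total (ℰ : LocExpansion Φ) (φ : Φ) : ℂ := ∑ X : ℰ.sys.Dom, ℰ.E X φ

/-- The exponential decay bound `|E(X, φ)| ≤ E₀ exp(-κ d_j(X))` on a domain `𝒰` of configurations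
(B12 (0.25), (1.18); Dimock I: `‖E‖_{k,κ} ≤ E₀`). [cite: Balaban1987RG1, (0.25) p.257] -/
def ExpDecayBound (ℰ : LocExpansion Φ) (𝒰 : Set Φ) (E₀ κ : ℝ) : Prop :=
  ∀ X φ, φ ∈ 𝒰 → ‖ℰ.E X φ‖ ≤ E₀ * Real.exp (-κ * ℰ.sys.dj X)

/-- The improved ("irrelevant") bound `|V(X, φ)| ≤ C (L^j η)^{4+α} exp(-κ d_j(X))` after extraction of the
β-function term (B12 (0.28)–(0.29)); `s = L^j η`. [cite: Balaban1987RG1, (0.29) p.258] -/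
def IrrelevantBound (ℰ : LocExpansion Φ) (𝒰 : Set Φ) (C s α κ : ℝ) : Prop :=
  ∀ X φ, φ ∈ 𝒰 → ‖ℰ.E X φ‖ ≤ C * s ^ (4 + α) * Real.exp (-κ * ℰ.sys.dj X)

/-- Dependence of `E(X, ·)` on the configuration restricted to `X` only (B12 p. 257, (1.7)), expressed through an
abstract "agree on X" relation. [cite: Balaban1987RG1, §0 p.257] -/
def LocalDependence (ℰ : LocExpansion Φ) (agreeOn : ℰ.sys.Dom → Φ → Φ → Prop) : Prop :=
  ∀ X φ ψ, agreeOn X φ ψ → ℰ.E X φ = ℰ.E X ψ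

end LocExpansion

/-- The COMPLEX regular spaces `Uᶜ_j(X, α₀, α₁, γ₀)` (B12 p. 262, conditions (i)–(iv)) = the analyticity domains of
the localized terms, abstracted to a family of sets of (complex) configurations indexed by the domain `X` and the
three radii, monotone in the radii (B12 p. 263).  Conditions (i)–(iv) themselves are reader-owned (B12 §1); see
NOTATION §12.4 (DIVERGENCE F8). [cite: Balaban1987RG1, §1 p.262] -/
structure CplxRegularSpace (Dom : Type*) (Φ : Type*) where
  mem : Dom → ℝ → ℝ → ℝ → Set Φ
  mono : ∀ X α₀ α₀' α₁ α₁' γ₀ γ₀', α₀ ≤ α₀' → α₁ ≤ α₁' → γ₀ ≤ γ₀' →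
    mem X α₀ α₁ γ₀ ⊆ mem X α₀' α₁' γ₀'

/-! ## 12. Background fields (NOTATION §10) -/

section Background
variable {P : Params} {G : Type*} [GaugeGroup G]

/-- `IsBackground av reg k V U₀`: `U₀ = U_k(V)` is a minimiser of the (`d = 4`) Wilson action on the constraint
surface `{U : M^k(U) = V}` within the class `reg` of regular configurations (B12 (0.21), (1.1); B11 Thm 1 asserts
existence and uniqueness modulo gauge of such a minimal orbit — a QUOTED LEAF, not asserted here). [cite: Balaban1985Variational, Thm 1 p.279] -/
def IsBackground (av : ∀ j, Averaging P j G) (reg : Set (GaugeField P 0 G)) (k : ℕ)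
    (V : GaugeField P k G) (U₀ : GaugeField P 0 G) : Prop :=
  Averaging.iter av k U₀ = V ∧ U₀ ∈ reg ∧
    ∀ U : GaugeField P 0 G, U ∈ reg → Averaging.iter av k U = V → wilsonAction4 U₀ ≤ wilsonAction4 U

/-- A background-field assignment `V ↦ U_k(V)` for every step, as DATA, with its defining property on a domain of
regular `V` (B12 p. 260). [cite: Balaban1985Variational, Thm 1 p.279] -/
structure Background (P : Params) (G : Type*) [GaugeGroup G] (av : ∀ j, Averaging P j G) where
  reg : Set (GaugeField P 0 G)
  dom : (k : ℕ) → Set (GaugeField P k G)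
  U : (k : ℕ) → GaugeField P k G → GaugeField P 0 G
  isBackground : ∀ k V, V ∈ dom k → IsBackground av reg k V (U k V)

end Background

/-! ## 13. Effective actions and the small-field RG step (NOTATION §8.3, §11) -/

section EffAction
variable {P : Params} {G : Type*} [GaugeGroup G] [MeasurableSpace G] [HaarData G]

/-- One small-field renormalization step (B12 (0.19)):
`exp A_{k+1}(V) = N_k⁻¹ ∫ dU δ(Ū V⁻¹) χ_k(U) exp[-(1/g_k²) G(U) + A_k(U)]`, `N_k` = the same integral at `V = 1`,
stated through an RT operator `T` (push-forward reading, DIVERGENCE F7): `T(χ_k e^{-GF/g_k² + A_k}) = N_k e^{A_{k+1}}`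
with `A_{k+1}(1) = 0`. [cite: Balaban1987RG1, (0.19) p.255] -/
def SmallFieldStep {k : ℕ} {av : Averaging P k G} (T : RTOp P k G av) (χ GF : Density P k G) (gk : ℝ)
    (A : Density P k G) (A' : Density P (k+1) G) : Prop :=
  ∃ N : ℝ, 0 < N ∧
    T.T (fun U => χ U * Real.exp (-(1 / gk ^ 2) * GF U + A U)) = (fun V => N * Real.exp (A' V)) ∧ A' 1 = 0

/-- OPERATOR-LEVEL form of the small-field step (B12 (0.19)), v1.4: the same proposition as `SmallFieldStep` but binding only
the operator `T : Density_k → Density_{k+1}` — (0.19) uses `T` through `T(χ_k e^{-GF/g_k² + A_k}) = N_k e^{A_{k+1}}`,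
`A_{k+1}(1) = 0` and through nothing else, so this is the form to bind when the RT carrier is `RTOpI` (or when no RT axiom is
needed at all).  `SmallFieldStep T … = SmallFieldStepOp T.T …` holds by `rfl` (`smallFieldStep_eq_op`). [cite: Balaban1987RG1, (0.19) p.255] -/
def SmallFieldStepOp {k : ℕ} (T : Density P k G → Density P (k+1) G) (χ GF : Density P k G) (gk : ℝ)
    (A : Density P k G) (A' : Density P (k+1) G) : Prop :=
  ∃ N : ℝ, 0 < N ∧
    T (fun U => χ U * Real.exp (-(1 / gk ^ 2) * GF U + A U)) = (fun V => N * Real.exp (A' V)) ∧ A' 1 = 0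

/-- The small-field step (B12 (0.19)) over the INHABITED carrier `RTOpI` (v1.3/v1.4; DIVERGENCE F17): by definition the
operator-level form applied to `T.T`. [cite: Balaban1987RG1, (0.19) p.255] -/
def SmallFieldStepI {k : ℕ} {av : Averaging P k G} (T : RTOpI P k G av) (χ GF : Density P k G) (gk : ℝ)
    (A : Density P k G) (A' : Density P (k+1) G) : Prop :=
  SmallFieldStepOp T.T χ GF gk A A'

/-- `SmallFieldStep` is the operator-level form at `T.T` (definitional). [folklore] -/
theorem smallFieldStep_eq_op {k : ℕ} {av : Averaging P k G} (T : RTOp P k G av) (χ GF : Density P k G) (gk : ℝ)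
    (A : Density P k G) (A' : Density P (k+1) G) :
    SmallFieldStep T χ GF gk A A' = SmallFieldStepOp T.T χ GF gk A A' := rfl

/-- `SmallFieldStepI` is the operator-level form at `T.T` (definitional). [folklore] -/
theorem smallFieldStepI_eq_op {k : ℕ} {av : Averaging P k G} (T : RTOpI P k G av) (χ GF : Density P k G) (gk : ℝ)
    (A : Density P k G) (A' : Density P (k+1) G) :
    SmallFieldStepI T χ GF gk A A' = SmallFieldStepOp T.T χ GF gk A A' := rfl

/-- Bridge from the `RTOp` form to the `RTOpI` form along `RTOp.toRTOpI` (definitional). [folklore] -/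
theorem smallFieldStep_iff_I {k : ℕ} {av : Averaging P k G} (T : RTOp P k G av) (χ GF : Density P k G) (gk : ℝ)
    (A : Density P k G) (A' : Density P (k+1) G) :
    SmallFieldStep T χ GF gk A A' ↔ SmallFieldStepI T.toRTOpI χ GF gk A A' := Iff.rfl

/-- The data of the sequence of small-field effective actions `A_k`, `k = 0..K` (B12 (0.17)–(0.23)). [cite: Balaban1987RG1, (0.22) p.256] -/
structure EffActionSeq (P : Params) (G : Type*) [GaugeGroup G] where
  A : (k : ℕ) → Density P k G
  flow : Flow

/-- The representation `A_k(V) = -(1/g_k²) A(U_k(V)) + E_k(U_k(V))` (B12 (0.22)) on the domain of the background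
field, with `E_k` given as a function of the finest-lattice configuration. [cite: Balaban1987RG1, (0.22) p.256] -/
def EffActionSeq.Representation (S : EffActionSeq P G) {av : ∀ j, Averaging P j G} (bg : Background P G av)
    (E : (k : ℕ) → GaugeField P 0 G → ℝ) : Prop :=
  ∀ k V, V ∈ bg.dom k → S.A k V = -(1 / (S.flow.g k) ^ 2) * wilsonAction4 (bg.U k V) + E k (bg.U k V)

/-- ULTRAVIOLET STABILITY in the sense of B12 (0.30)/p. 259: `|E_k(U_k(V))| ≤ C · M⁻⁴ · |T_1^{(k)}|` with `C`
independent of `k ≤ K` (hence of `ε = L^{-K}`), `|T_1^{(k)}| = ` number of sites of `T^{(k)}`. [cite: Balaban1987RG1, (0.30) p.259] -/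
def UVStableBound (bg_dom : (k : ℕ) → Set (GaugeField P k G)) (bgU : (k : ℕ) → GaugeField P k G → GaugeField P 0 G)
    (E : (k : ℕ) → GaugeField P 0 G → ℝ) (C M : ℝ) (K : ℕ) : Prop :=
  ∀ k ≤ K, ∀ V ∈ bg_dom k, |E k (bgU k V)| ≤ C * M⁻¹ ^ 4 * (Fintype.card (Site P k) : ℝ)

end EffAction

/-! ## 14. Large-field bookkeeping (NOTATION §12.5) — letters only -/

/-- Large-field data of one density: the finite set of possible large-field regions `Z` and the decomposition
`ρ(V) = Σ_Z ρ(Z, V)` (B15 (0.2)); the admissible sequences `Ω_j ⊃ …`, `Λ_j`, `Z_j` and the seven groups of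
characteristic functions (B15 (1.3)–(1.9)) are reader-owned (DIVERGENCE F9). [cite: Balaban1989LargeFieldI, (0.3)/(0.6) p.176] -/
structure LargeFieldDecomp (P : Params) (j : ℕ) (G : Type*) [GaugeGroup G] where
  Region : Type
  [fin : Fintype Region]
  piece : Region → Density P j G
  nonneg : ∀ Z V, 0 ≤ piece Z V

attribute [instance] LargeFieldDecomp.fin

namespace LargeFieldDecomp
variable {P : Params} {j : ℕ} {G : Type*} [GaugeGroup G]
/-- `ρ(V) = Σ_Z ρ(Z, V)`. [cite: Balaban1987RG1, (0.24) p.257] -/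
noncomputable def total (D : LargeFieldDecomp P j G) : Density P j G := fun V => ∑ Z : D.Region, D.piece Z V
end LargeFieldDecomp

/-! ## 15. The record of constants (NOTATION §13) -/

/-- The constants of the inductive hypotheses, with the roles of NOTATION §13 (dependences are HYPOTHESES of the
theorems that use them, never fixed here). [cite: Balaban1987RG1, §0–§1 pp.251–263] -/
structure Consts where
  M : ℕ      -- size of localization cubes, `M = L^{m'}`
  M₀ : ℕ     -- decay scale of basic propagators
  M₁ : ℕ     -- scale of the variational theorems (B11)
  M₂ : ℕ     -- intermediate scale, `M₁ < M₂ < M`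
  r : ℕ      -- `R_j ≥ (log g_j⁻²)^r`, `r ≥ 2`
  p₀ : ℕ     -- exponent in `p₀(g)`, `p₀ ≥ 5 r`
  A₀ : ℝ     -- prefactor in `p₀(g)`
  A₁ : ℝ     -- `δ_k = (A₁/A₀) ε_k`, `A₁ ≪ A₀`
  ε₀ : ℝ     -- radius of `U_k(ε₀)`
  ε₁ : ℝ
  α₀ : ℝ     -- radii of `Uᶜ_j(X, α₀, α₁, γ₀)`
  α₁ : ℝ
  γ₀ : ℝ
  γ : ℝ      -- coupling interval `]0, γ]`
  κ : ℝ      -- decay rate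
  E₀ : ℝ     -- prefactor of localized terms
  αgain : ℝ  -- `α > 0` in `(L^j η)^{4+α}`
  N : ℕ      -- remembered steps in `R` (B15)

/-- The ordering constraints among the scales printed in B12 p. 257 / B14 p. 245. [cite: Balaban1987RG1, §0 p.257] -/
def Consts.ScalesOrdered (C : Consts) : Prop := C.M₀ < C.M ∧ C.M₁ < C.M₂ ∧ C.M₂ < C.M ∧ 2 ≤ C.r ∧ 5 * C.r ≤ C.p₀

end Literature.MathematicalPhysics.QuantumFieldTheory.Balaban1983to89
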